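import Summits.BirchSwinnertonDyer.BirchSwinnertonDyer.Theorems.ByReductionTypeAtTwoMultLowerHalfSelmerRank
import Summits.BirchSwinnertonDyer.Rank1Residual.X5.TwoAdicTargetsMultKatoIntSplitPos
import HarnessLib

/-!
# Route `ByReductionTypeAtTwo`, child `MultLowerHalfAtTwo` (item stmt-BirchSwinnertonDyer-19923): the SPLIT
# Kato-INT pinch doors at `2` with the MEMO binder `hlow : X5.O1.SelmerLambdaLowerBoundAtTwo W n` DISCHARGED
# (PRINT Greenberg 1999 Prop. 4.14@2 + one finite-layer count) — companion of `…MultLowerHalfSelmerRank.lean`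

HONEST FRAMING (cell `bsd-2adic`, run/shared/lean/pub/bsd-2adic/, seat `bsd-2adic-mult-3` GEN 6, HUMAN
RULINGS D-0036 / D-0054 / D-0074 row (A)): research route; THEOREMS ONLY — no definition, no new named fact,
nothing asserted, nothing booked; BSD is not proved by any of this. PARTITION (D-0054): X5@2 mult, SPLIT,
`E[2]` irreducible (K4ᵐ, RESIDUAL-MAP B1·O1; of the 1 976 book230 classes: the 437 split ∧ surjective ∧ `Δ < 0`
classes of CENSUS-6 — first the 97 TIER-1-SPLIT classes of `X5/TwoAdicInstancesINTSP*.lean` (p43xxxx,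
`λ_an = 3 = s₂ + 1`) — and the 36 split `Δ > 0` tier-1 classes of door 34-INT-pinch-split⁺ p443104) × p = 2 —
types-the-object-of (item 19923 per class: the `λ`-LOWER input of the pinch); closes none by itself.

WHAT THIS FILE DOES. The companion file proves `X5.O1.SelmerLambdaLowerBoundAtTwo W n` — the `hlow` binder of
every Kato-INT pinch door, hitherto MEMO (HOME/mult/PROOF-KATO2MULT.md §6.2) — from the PUBLISHED Greenberg
1999 Prop. 4.14 at `2` (`Greenberg1999.prop414_noFiniteSubmodule_of_not_dvd_torsionOrder`, audit PASS) and ONE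
finite-layer certificate `2^n ≤ #Sel_{2^∞}(E/ℚ_j)[2]` (`MultSelmerRank.selmerLambdaLowerBoundAtTwo_of_layerSelmer`,
any reduction type, no tower gap). Here the SPLIT doors are re-glued with that discharge, one application each:
* §1 `bsdp_two_split_of_katoInt_of_layerSelmer` / `…_of_selmerTwoTorsion` (`X5.O1.bsdp_two_split_of_katoIntPinch`,
  p433154: T-KATO2-SPMULT `hKint` + `greenberg_stevens W 2`) and the rank-`0` `2`-converse
  `analyticRank_eq_zero_of_finite_selmer_of_katoIntSplit_of_layerSelmer`;
* §2 the `Δ > 0` face `bsdp_two_split_of_katoUpToOnePinch_of_mu_of_layerSelmer` (+ converse) of p443104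
  (slack-one datum `hK1sp` + the displayed `μ(X) = 0` hypothesis `hμX`), with the torsion side condition
  `2 ∤ #E(ℚ)_tors` displayed (`htors`; automatic from a `TwoAdicSurjective` certificate, companion §0);
* §3 `missingLowerBoundAt_two_split_of_katoInt_of_layerSelmer`: the instance of item 19923
  (`Typed.MissingLowerBoundAt W 2`) at a split tier-1/2 curve.

WHAT IS DISPLAYED, NOT PROVED (numbers, not adjectives). PRINT: Greenberg's split display A236 (`h41`, audit
V3 PASS), Prop. 4.14@2 (`h414`), modularity, GZK. NAMED FACT beyond its printed range: `greenberg_stevens W 2`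
(`hGS`; GS93 `p ≥ 5`, Kobayashi 2006 odd `p`; at `2` the cell memo PROOF-GS2, RC-4 PASS). MEMO: T-KATO2-SPMULT
(`hKint`, PROOF-KATO2SPLIT Thm. B, referee pending) resp. the slack-one datum `hK1sp` + `hμX` (§2) — UNCHANGED.
CERTIFICATES per class: `λ_an = n + 1` (`hlan`), `μ_an = 0` (`hμan`) (two-engine, kit j252619 × eng-2
TABLE-MULT-E2.v3: 97/97 tier-1-split rows `(0, 3)`), `hper₀` (§2 only), and the NEW slot
`2^n ≤ #Sel_{2^∞}(E/ℚ_j)[2]` — at `j = 0`, `n = 2`: the two-engine `dim_{𝔽₂} Sel₂(E/ℚ) = 2`, `E(ℚ)[2] = 0`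
(CENSUS-6 `ellrank`, CERT-SEL2-AB-X5ALL). ∀-LEVEL CONTENT for 19923: none (open mathematics, seat verdict
GEN 0–6); the file removes the memo binder `hlow` from the split per-class road.

References: R. Greenberg, LNM 1716 (1999), §1 p. 60, §3 pp. 85–86 and p. 94, Prop. 4.14 (p. 124), §4
pp. 112–113; R. Greenberg, G. Stevens, Invent. Math. 111 (1993), (0.6); S. Kobayashi, Doc. Math. Extra Vol.
Coates (2006), Cor. 4.2; K. Kato, Astérisque 295 (2004), 17.11–17.13; B. Mazur, J. Tate, J. Teitelbaum,
Invent. Math. 84 (1986), §I.14–15, §II; R. L. Miller, LMS J. Comput. Math. 14 (2011), Def. 1.1;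
L. Washington, *Introduction to Cyclotomic Fields*, §13.2.
-/

set_option autoImplicit false
set_option linter.dupNamespace false

noncomputable section

open scoped Classical MatrixGroups ModularForm

open CongruenceSubgroup WeierstrassCurve Literature.NumberTheory.EllipticCurves
  Literature.NumberTheory.EllipticCurves.ModularForms
  Literature.NumberTheory.EllipticCurves.Greenberg1999
  Literature.NumberTheory.EllipticCurves.Rank1Residual
  Literature.NumberTheory.EllipticCurves.Rank1Residual.Typed Summit.BirchSwinnertonDyer.Rank1Residual
  Summit.BirchSwinnertonDyer.Rank1Residual.X5 Summit.BirchSwinnertonDyer.Rank1Residual.X5.O1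

namespace Summit.BirchSwinnertonDyer.BirchSwinnertonDyer.Theorems.MultSelmerRank

variable (W : WeierstrassCurve ℚ) [W.IsElliptic] [W.IsGloballyMinimal]

/-! ## §1 Door 34-INT-pinch-split (`Δ < 0`, surjective) with `hlow` discharged -/

/-- **DOOR (34-INT-pinch-split) with `hlow` DISCHARGED — `BSDp W 2`, both halves, at a SPLIT `2` with
`ρ_{E,2^∞}` surjective and `Δ < 0`.** Binders: PRINT {A236 `h41`, modularity `hmod`, GZK `hGZK`, Greenberg
Prop. 4.14@2 `h414`}; the named fact `greenberg_stevens W 2` (`hGS`); MEMO {T-KATO2-SPMULT `hKint`} ONLY;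
CERTIFICATES {`λ_an(E) = n + 1` (`hlan`, trivial zero included), `μ_an(E) = 0` (`hμan`), the layer count
`2^n ≤ #Sel_{2^∞}(E/ℚ_j)[2]` (`hsel`)}; the curve's decidable data {`Mult W 2`, split, `TwoAdicSurjective W`,
`Δ < 0`}; analytic rank `0`. One application of `X5.O1.bsdp_two_split_of_katoIntPinch` (p433154) to the
companion's `selmerLambdaLowerBoundAtTwo_of_layerSelmer_of_twoAdicSurjective`.
[cite: GreenbergLNM1716, §4 pp. 112–113 (split l_v), §3 p. 94 and Prop. 4.14 (p. 124)]
[cite: MazurTateTeitelbaum1986Invent, §I.14–15 and §II] [cite: Miller2011LMS, Def. 1.1 and §1] -/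
theorem bsdp_two_split_of_katoInt_of_layerSelmer {j n : ℕ}
    (h41 : thm41Analogue_charValue_rankZero_split_baseChange_anyPrime)
    (hGS : greenberg_stevens (W := W) (p := 2))
    (hmod : nonempty_modularParametrizationData)
    (hGZK : rank_eq_analyticRank_of_analyticRank_le_one)
    (h414 : prop414_noFiniteSubmodule_of_not_dvd_torsionOrder)
    (hKint : KatoDivisibilityAtTwoSplitMultInt W)
    (hr : W.analyticRank = 0) (hmult : Mult W 2) (hsp : W.HasSplitMultiplicativeReductionAtPrime 2)
    (him : TwoAdicSurjective W) (hΔ : W.Δ < 0)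
    (hlan : X2.AnalyticLambdaEq W 2 (n + 1)) (hμan : X2.AnalyticMuLE W 2 0)
    (hsel : ∀ κ : ZpExtension ℚ 2, κ.IsCyclotomic →
      2 ^ n ≤ Nat.card {z : W.selmerLayer κ j // 2 • z = 0}) : BSDp W 2 :=
  bsdp_two_split_of_katoIntPinch W h41 hGS hmod hGZK hKint
    (selmerLambdaLowerBoundAtTwo_of_layerSelmer_of_twoAdicSurjective W h414 him hsel)
    hr hmult hsp him hΔ hlan hμan

/-- **DOOR (34-INT-pinch-split) with `hlow` DISCHARGED from the layer-`0` count `2^n ≤ #Sel_{2^∞}(E/ℚ)[2]`**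
(the TIER-1-SPLIT habitat: `n = 2 = dim_{𝔽₂} Sel₂(E/ℚ)`, `λ_an = 3`): `BSDp W 2` with MEMO {`hKint`} only.
[cite: GreenbergLNM1716, §4 pp. 112–113 and Prop. 4.14 (p. 124)] [cite: MazurTateTeitelbaum1986Invent, §I.14–15]
[cite: Miller2011LMS, Def. 1.1 and §1] -/
theorem bsdp_two_split_of_katoInt_of_selmerTwoTorsion {n : ℕ}
    (h41 : thm41Analogue_charValue_rankZero_split_baseChange_anyPrime)
    (hGS : greenberg_stevens (W := W) (p := 2))
    (hmod : nonempty_modularParametrizationData)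
    (hGZK : rank_eq_analyticRank_of_analyticRank_le_one)
    (h414 : prop414_noFiniteSubmodule_of_not_dvd_torsionOrder)
    (hKint : KatoDivisibilityAtTwoSplitMultInt W)
    (hr : W.analyticRank = 0) (hmult : Mult W 2) (hsp : W.HasSplitMultiplicativeReductionAtPrime 2)
    (him : TwoAdicSurjective W) (hΔ : W.Δ < 0)
    (hlan : X2.AnalyticLambdaEq W 2 (n + 1)) (hμan : X2.AnalyticMuLE W 2 0)
    (hsel : 2 ^ n ≤ Nat.card {z : W.selmerGroupPInfty 2 // 2 • z = 0}) : BSDp W 2 :=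
  bsdp_two_split_of_katoIntPinch W h41 hGS hmod hGZK hKint
    (selmerLambdaLowerBoundAtTwo_of_selmerTwoTorsion W h414
      (not_two_dvd_torsionOrder_of_twoAdicSurjective W him) hsel)
    hr hmult hsp him hΔ hlan hμan

/-- **DOOR (34-INT-pinch-split), CONVERSE FORM, with `hlow` DISCHARGED** (the S3ᵐ lane's rank-`0` `2`-converse
at a split class): same inputs MINUS analytic rank `0` and GZK; `Sel_{2^∞}(E/ℚ)` finite ⇒
`L(E,1) ≠ 0 ∧ r_an(E) = 0`. [cite: GreenbergLNM1716, §4 pp. 112–113 and Prop. 4.14 (p. 124)]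
[cite: MazurTateTeitelbaum1986Invent, §I.14–15 and §II] -/
theorem analyticRank_eq_zero_of_finite_selmer_of_katoIntSplit_of_layerSelmer {j n : ℕ}
    (h41 : thm41Analogue_charValue_rankZero_split_baseChange_anyPrime)
    (hGS : greenberg_stevens (W := W) (p := 2))
    (hmod : nonempty_modularParametrizationData)
    (h414 : prop414_noFiniteSubmodule_of_not_dvd_torsionOrder)
    (hKint : KatoDivisibilityAtTwoSplitMultInt W)
    (hmult : Mult W 2) (hsp : W.HasSplitMultiplicativeReductionAtPrime 2)
    (him : TwoAdicSurjective W) (hΔ : W.Δ < 0)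
    (hlan : X2.AnalyticLambdaEq W 2 (n + 1)) (hμan : X2.AnalyticMuLE W 2 0)
    (hsel : ∀ κ : ZpExtension ℚ 2, κ.IsCyclotomic →
      2 ^ n ≤ Nat.card {z : W.selmerLayer κ j // 2 • z = 0})
    (hfin : Finite (W.selmerGroupPInfty 2)) : W.entireLFunction 1 ≠ 0 ∧ W.analyticRank = 0 :=
  analyticRank_eq_zero_of_finite_selmer_of_katoIntSplitPinch W h41 hGS hmod hKint
    (selmerLambdaLowerBoundAtTwo_of_layerSelmer_of_twoAdicSurjective W h414 him hsel)
    hmult hsp him hΔ hlan hμan hfin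

/-! ## §2 Door 34-INT-pinch-split⁺ (`Δ > 0` face, slack one, `μ(X) = 0` displayed) with `hlow` discharged -/

/-- **DOOR (34-INT-pinch-split⁺) with `hlow` DISCHARGED — `BSDp W 2` at a SPLIT `2` from the slack-ONE datum.**
Binders: PRINT {A236 `h41`, `hmod`, `hGZK`, Prop. 4.14@2 `h414`}; `greenberg_stevens W 2` (`hGS`); MEMO {the
slack-one divisibility `hK1sp` (`ι(T·g) = 2ϖ·L`, `g ∈ char X`)}; the HYPOTHESIS `hμX : μ(X(E/ℚ_∞)) = 0`
(displayed, not discharged); CERTIFICATES {`hlan` (`n + 1`), `hμan`, `hper₀`, the layer count `hsel`}; the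
torsion side condition `2 ∤ #E(ℚ)_tors` (`htors`; e.g. from a `TwoAdicSurjective` certificate,
`not_two_dvd_torsionOrder_of_twoAdicSurjective`); {`Mult W 2`, split}; analytic rank `0`. One application of
`X5.O1.bsdp_two_split_of_katoUpToOnePinch_of_mu` (p443104).
[cite: GreenbergLNM1716, §4 pp. 112–113 (split l_v), Conj. 1.11 and Prop. 4.14 (p. 124)]
[cite: MazurTateTeitelbaum1986Invent, §I.10, §I.14–15 and §II] [cite: Miller2011LMS, Def. 1.1 and §1] -/
theorem bsdp_two_split_of_katoUpToOnePinch_of_mu_of_layerSelmer {j n : ℕ}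
    (h41 : thm41Analogue_charValue_rankZero_split_baseChange_anyPrime)
    (hGS : greenberg_stevens (W := W) (p := 2))
    (hmod : nonempty_modularParametrizationData)
    (hGZK : rank_eq_analyticRank_of_analyticRank_le_one)
    (h414 : prop414_noFiniteSubmodule_of_not_dvd_torsionOrder)
    (hK1sp : ∀ (κ : ZpExtension ℚ 2) (γ : Field.absoluteGaloisGroup ℚ), κ.IsCyclotomic →
      κ.IsTopGenerator γ → IsCyclotomicVariable 2 γ →
      ∀ [NeZero (W.conductorNorm ℤ)] (f : CuspForm (Gamma0 (W.conductorNorm ℤ)) 2), IsNewformOf W f →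
      ∀ ϖ : ℚ, (ϖ : ℝ) * W.realPeriodRat = plusPeriod f →
      ∀ L : PowerSeries ℚ_[2], IsSplitMultPAdicLFunctionOf f 2 L → ∀ D : W.SelmerDualData κ γ,
        D.IsTorsion ∧ ∃ g ∈ D.charIdeal,
          iwasawaToPowerSeries 2 (PowerSeries.X * g) = PowerSeries.C ((2 * ϖ : ℚ) : ℚ_[2]) * L)
    (hμX : ∀ (κ : ZpExtension ℚ 2) (γ : Field.absoluteGaloisGroup ℚ), κ.IsCyclotomic →
      κ.IsTopGenerator γ → IsCyclotomicVariable 2 γ → ∀ D : W.SelmerDualData κ γ, D.IsTorsion → D.mu = 0)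
    (hper₀ : ∀ [NeZero (W.conductorNorm ℤ)] (f : CuspForm (Gamma0 (W.conductorNorm ℤ)) 2),
      IsNewformOf W f → ∀ ϖ : ℚ, (ϖ : ℝ) * W.realPeriodRat = plusPeriod f → 0 ≤ padicValRat 2 ϖ)
    (htors : ¬ 2 ∣ W.torsionOrder)
    (hr : W.analyticRank = 0) (hmult : Mult W 2) (hsp : W.HasSplitMultiplicativeReductionAtPrime 2)
    (hlan : X2.AnalyticLambdaEq W 2 (n + 1)) (hμan : X2.AnalyticMuLE W 2 0)
    (hsel : ∀ κ : ZpExtension ℚ 2, κ.IsCyclotomic →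
      2 ^ n ≤ Nat.card {z : W.selmerLayer κ j // 2 • z = 0}) : BSDp W 2 :=
  bsdp_two_split_of_katoUpToOnePinch_of_mu W h41 hGS hmod hGZK hK1sp hμX
    (selmerLambdaLowerBoundAtTwo_of_layerSelmer W h414 htors hsel) hper₀ hr hmult hsp hlan hμan

/-- **DOOR (34-INT-pinch-split⁺), CONVERSE FORM, with `hlow` DISCHARGED:** same inputs MINUS analytic rank `0`
and GZK; `Sel_{2^∞}(E/ℚ)` finite ⇒ `L(E,1) ≠ 0 ∧ r_an(E) = 0`.
[cite: GreenbergLNM1716, §4 pp. 112–113, Conj. 1.11 and Prop. 4.14 (p. 124)]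
[cite: MazurTateTeitelbaum1986Invent, §I.14–15 and §II] -/
theorem analyticRank_eq_zero_of_finite_selmer_of_katoUpToOneSplitPinch_of_mu_of_layerSelmer {j n : ℕ}
    (h41 : thm41Analogue_charValue_rankZero_split_baseChange_anyPrime)
    (hGS : greenberg_stevens (W := W) (p := 2))
    (hmod : nonempty_modularParametrizationData)
    (h414 : prop414_noFiniteSubmodule_of_not_dvd_torsionOrder)
    (hK1sp : ∀ (κ : ZpExtension ℚ 2) (γ : Field.absoluteGaloisGroup ℚ), κ.IsCyclotomic →
      κ.IsTopGenerator γ → IsCyclotomicVariable 2 γ →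
      ∀ [NeZero (W.conductorNorm ℤ)] (f : CuspForm (Gamma0 (W.conductorNorm ℤ)) 2), IsNewformOf W f →
      ∀ ϖ : ℚ, (ϖ : ℝ) * W.realPeriodRat = plusPeriod f →
      ∀ L : PowerSeries ℚ_[2], IsSplitMultPAdicLFunctionOf f 2 L → ∀ D : W.SelmerDualData κ γ,
        D.IsTorsion ∧ ∃ g ∈ D.charIdeal,
          iwasawaToPowerSeries 2 (PowerSeries.X * g) = PowerSeries.C ((2 * ϖ : ℚ) : ℚ_[2]) * L)
    (hμX : ∀ (κ : ZpExtension ℚ 2) (γ : Field.absoluteGaloisGroup ℚ), κ.IsCyclotomic →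
      κ.IsTopGenerator γ → IsCyclotomicVariable 2 γ → ∀ D : W.SelmerDualData κ γ, D.IsTorsion → D.mu = 0)
    (hper₀ : ∀ [NeZero (W.conductorNorm ℤ)] (f : CuspForm (Gamma0 (W.conductorNorm ℤ)) 2),
      IsNewformOf W f → ∀ ϖ : ℚ, (ϖ : ℝ) * W.realPeriodRat = plusPeriod f → 0 ≤ padicValRat 2 ϖ)
    (htors : ¬ 2 ∣ W.torsionOrder)
    (hmult : Mult W 2) (hsp : W.HasSplitMultiplicativeReductionAtPrime 2)
    (hlan : X2.AnalyticLambdaEq W 2 (n + 1)) (hμan : X2.AnalyticMuLE W 2 0)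
    (hsel : ∀ κ : ZpExtension ℚ 2, κ.IsCyclotomic →
      2 ^ n ≤ Nat.card {z : W.selmerLayer κ j // 2 • z = 0})
    (hfin : Finite (W.selmerGroupPInfty 2)) : W.entireLFunction 1 ≠ 0 ∧ W.analyticRank = 0 :=
  analyticRank_eq_zero_of_finite_selmer_of_katoUpToOneSplitPinch_of_mu W h41 hGS hmod hK1sp hμX
    (selmerLambdaLowerBoundAtTwo_of_layerSelmer W h414 htors hsel) hper₀ hmult hsp hlan hμan hfin

/-! ## §3 Item 19923 (`MultLowerHalfAtTwo`) AT a split tier-1/2 curve -/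

/-- **The instance of `MultLowerHalfAtTwo` (item 19923) at a split, `2`-adically surjective, `Δ < 0` curve of
analytic rank `0`: `Typed.MissingLowerBoundAt W 2`** from PRINT {`h41` (A236), `hmod`, `hGZK`, `h414`} + the named
fact `greenberg_stevens W 2` + MEMO {`hKint`} + CERTIFICATES {`hlan`, `hμan`, `hsel`} — through `BSDp W 2` (§1)
and the finiteness of `Ш` at analytic rank `0` (GZK). No `hlow`, no tower gap, no period datum.
[cite: Miller2011LMS, Def. 1.1 (arXiv:1010.2431 p. 3)] [cite: GreenbergLNM1716, Prop. 4.14 (p. 124)] -/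
theorem missingLowerBoundAt_two_split_of_katoInt_of_layerSelmer {j n : ℕ}
    (h41 : thm41Analogue_charValue_rankZero_split_baseChange_anyPrime)
    (hGS : greenberg_stevens (W := W) (p := 2))
    (hmod : nonempty_modularParametrizationData)
    (hGZK : rank_eq_analyticRank_of_analyticRank_le_one)
    (h414 : prop414_noFiniteSubmodule_of_not_dvd_torsionOrder)
    (hKint : KatoDivisibilityAtTwoSplitMultInt W)
    (hr : W.analyticRank = 0) (hmult : Mult W 2) (hsp : W.HasSplitMultiplicativeReductionAtPrime 2)
    (him : TwoAdicSurjective W) (hΔ : W.Δ < 0)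
    (hlan : X2.AnalyticLambdaEq W 2 (n + 1)) (hμan : X2.AnalyticMuLE W 2 0)
    (hsel : ∀ κ : ZpExtension ℚ 2, κ.IsCyclotomic →
      2 ^ n ≤ Nat.card {z : W.selmerLayer κ j // 2 • z = 0}) : MissingLowerBoundAt W 2 := by
  haveI : Finite W.sha := (hGZK W (by rw [hr]; exact zero_le_one)).2
  exact (lower_and_upper_of_missingPPartAt W 2 (missingPPartAt_of_bsdp W 2
    (bsdp_two_split_of_katoInt_of_layerSelmer W h41 hGS hmod hGZK h414 hKint hr hmult hsp him hΔ hlan hμan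
      hsel))).1

end Summit.BirchSwinnertonDyer.BirchSwinnertonDyer.Theorems.MultSelmerRank

end
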